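import Mathlib
import HarnessLib
import Literature.Analysis.FluidPDE.SelfSimilar
import Literature.Analysis.FluidPDE.TypeIAncientMild
import Literature.Analysis.FluidPDE.ClassicalSupStabilityMild
import Literature.Analysis.FluidPDE.NSBoundedMildSmoothing
import Literature.Analysis.FluidPDE.ClassicalSolutionGlue
import Literature.Analysis.FluidPDE.ForcedOseenRepresentationClassical
import Literature.Analysis.FluidPDE.ClassicalNSBlowupAlternative
import Literature.Analysis.FluidPDE.BoundedMildSpatialDecay
import Summits.NavierStokesRegularity.NavierStokesRegularity.Theorems.QuarterLogPincerThinCascadeDefs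
import Summits.NavierStokesRegularity.NavierStokesRegularity.Theorems.QuarterLogPincerTruncationEdgeAnatomyDefs

/-!
# Crux `QuarterLogPincer.TypeIQuantSubcubicExp` (stmt-NavierStokesRegularity-24077), EDGE line `truncation_edge` (ns-idea-7 g8/g9):
# piece **P2 `stub_frameBootstrap : StubFrameBootstrap` BY NAME** — the frame bootstrap (NS-generic continuation under a closeness barrier)

Tree copy of the AUTHOR'S PROOF (ns-idea-7 g9, workfile `Cruxes/TypeIQuantSubcubicExp/Lines/truncation_edge.lean` v1.6, section
«P2 `FrameBootstrap` PROVED», VERBATIM), re-homed by the pub-ns-dss typer (g35; `--supports stmt-NavierStokesRegularity-24077`,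
helper) so that P2 of the T1 anatomy is discharged by name in `Theorems/` over the re-homed objects of `…TruncationEdgeAnatomyDefs`.
The argument (author's): Leray's alternative for smooth finite-energy solutions (`finiteEnergy_classical_dichotomy`: global on closed
slabs, or a maximal solution with UNBOUNDED velocity), Tao's persistence of regularity (`hasBoundedSobolevNormsOn_of_sobolevDatum_unforced`)
and the connectedness argument `frame_close_of_improvement` (the `δ`-closeness caps the velocity by `sup|V| + δ`, excluding the blow-up
branch before time `T`); uniformity in `x` from the uniform spatial decay of frame solutions
(`IsClassicalNSSolutionOn.exists_forall_norm_le_of_datum_decay`).  Nothing is changed except this header; credit: ns-idea-7 g9.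
(An independent, importable road to the EXISTENCE part for the Type-I reference field is the typer's `…TruncationEdgeShadowExistence`.)

HONEST FRAME: NS-generic continuation lemma about hypothetical data; T1 (open piece: P3b′), 24077, 22144, W7 and NS regularity
OPEN / not proved.
-/

noncomputable section

-- the summit-side namespace repeats a component by design (D-0017)
set_option linter.dupNamespace false

namespace Summit.NavierStokesRegularity.NavierStokesRegularity.Cruxes.TypeIQuantSubcubicExp.TruncationEdge

open MeasureTheory Set Function Metric Filter Topology
open scoped ENNReal NNReal
open Literature.Analysis Literature.Analysis.FluidPDE
open Summit.NavierStokesRegularity.NavierStokesRegularity.Cruxes.TypeIQuantSubcubicExp.ThinCascade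

/-! ### P2 `FrameBootstrap` (author's v1.6 proof, verbatim) -/

/-- `eLpNorm f 2 ≤ C` gives `∫⁻ ‖f‖ₑ² ≤ C²`. [folklore] -/
theorem lintegral_sq_le_of_eLpNorm_two_le {F : Type*} [NormedAddCommGroup F]
    {f : EuclideanSpace ℝ (Fin 3) → F} {C : ℝ≥0} (h : eLpNorm f 2 volume ≤ C) :
    ∫⁻ x, ‖f x‖ₑ ^ 2 ≤ (C : ℝ≥0∞) ^ 2 := by
  have h1 := h
  rw [eLpNorm_eq_lintegral_rpow_enorm_toReal two_ne_zero ENNReal.ofNat_ne_top,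
    ENNReal.toReal_ofNat] at h1
  simp only [one_div] at h1
  have h' := ENNReal.rpow_le_rpow h1 (z := 2) (by norm_num)
  rw [← ENNReal.rpow_mul, show (2 : ℝ)⁻¹ * 2 = 1 by norm_num, ENNReal.rpow_one] at h'
  simpa using h'

/-- `∫⁻ ‖f‖ₑ² ≤ C` gives `eLpNorm f 2 ≤ C^{1/2}`. [folklore] -/
theorem eLpNorm_two_le_of_lintegral_sq_le {F : Type*} [NormedAddCommGroup F]
    {f : EuclideanSpace ℝ (Fin 3) → F} {C : ℝ≥0} (h : ∫⁻ x, ‖f x‖ₑ ^ 2 ≤ C) :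
    eLpNorm f 2 volume ≤ ((C ^ (1 / 2 : ℝ) : ℝ≥0) : ℝ≥0∞) := by
  rw [eLpNorm_eq_lintegral_rpow_enorm_toReal two_ne_zero ENNReal.ofNat_ne_top,
    ENNReal.toReal_ofNat, ENNReal.coe_rpow_of_nonneg _ (by norm_num : (0 : ℝ) ≤ 1 / 2)]
  have h2 : ∫⁻ x, ‖f x‖ₑ ^ (2 : ℝ) ≤ (C : ℝ≥0∞) := by
    have : (fun x => ‖f x‖ₑ ^ (2 : ℝ)) = fun x => ‖f x‖ₑ ^ 2 := by
      funext x; exact ENNReal.rpow_ofNat _ 2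
    rw [this]; exact h
  exact ENNReal.rpow_le_rpow h2 (by norm_num)

/-- A classical solution in Tao's class is a Tao-frame solution. [folklore] -/
theorem taoFrame_of_class {T : ℝ}
    {u : ℝ → EuclideanSpace ℝ (Fin 3) → EuclideanSpace ℝ (Fin 3)} {p : ℝ → EuclideanSpace ℝ (Fin 3) → ℝ}
    (hcl : IsClassicalNSSolutionOn (Icc 0 T) 1 0 u p) (hsob : HasBoundedSobolevNormsOn (Icc 0 T) u) :
    TaoFrame T u p := by
  refine ⟨hcl, fun n => ?_⟩
  obtain ⟨C, hC⟩ := hsob n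
  exact ⟨C ^ (1 / 2 : ℝ), fun t ht => eLpNorm_two_le_of_lintegral_sq_le (hC t ht)⟩

/-- The energy clause of a Tao frame, `ℝ≥0` form. [folklore] -/
theorem TaoFrame.energy_nnreal {T : ℝ}
    {u : ℝ → EuclideanSpace ℝ (Fin 3) → EuclideanSpace ℝ (Fin 3)} {p : ℝ → EuclideanSpace ℝ (Fin 3) → ℝ}
    (hfr : TaoFrame T u p) : ∃ C : ℝ≥0, ∀ t ∈ Icc 0 T, ∫⁻ x, ‖u t x‖ₑ ^ 2 ≤ C := by
  obtain ⟨C, hC⟩ := hfr.2 0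
  refine ⟨C ^ 2, fun t ht => ?_⟩
  have h0 := hC t ht
  have hcongr : eLpNorm (iteratedFDeriv ℝ 0 (u t)) 2 volume = eLpNorm (u t) 2 volume :=
    eLpNorm_congr_norm_ae (Eventually.of_forall fun x => by simp)
  rw [hcongr] at h0
  have := lintegral_sq_le_of_eLpNorm_two_le h0
  simpa [ENNReal.coe_pow] using this

/-- The datum of a Tao frame lies in `H^∞`. [folklore] -/
theorem TaoFrame.sobolev_datum {T : ℝ}
    {u : ℝ → EuclideanSpace ℝ (Fin 3) → EuclideanSpace ℝ (Fin 3)} {p : ℝ → EuclideanSpace ℝ (Fin 3) → ℝ}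
    (hfr : TaoFrame T u p) (hT : 0 ≤ T) : ∀ m : ℕ, ∫⁻ x, ‖iteratedFDeriv ℝ m (u 0) x‖ₑ ^ 2 < ⊤ := by
  intro m
  obtain ⟨C, hC⟩ := hfr.2 m
  exact (lintegral_sq_le_of_eLpNorm_two_le (hC 0 ⟨le_rfl, hT⟩)).trans_lt
    (ENNReal.pow_lt_top ENNReal.coe_lt_top)

/-- Restriction of a Tao frame to a shorter slab. [folklore] -/
theorem TaoFrame.restrict {T T' : ℝ}
    {u : ℝ → EuclideanSpace ℝ (Fin 3) → EuclideanSpace ℝ (Fin 3)} {p : ℝ → EuclideanSpace ℝ (Fin 3) → ℝ}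
    (hfr : TaoFrame T u p) (hT' : 0 < T') (hle : T' ≤ T) : TaoFrame T' u p :=
  ⟨hfr.1.mono (Icc_subset_Icc_right hle) (uniqueDiffOn_Icc hT'), fun n => by
    obtain ⟨C, hC⟩ := hfr.2 n
    exact ⟨C, fun t ht => hC t ⟨ht.1, ht.2.trans hle⟩⟩⟩

/-! ### P2 — the connectedness argument -/

/-- **The closeness barrier propagates** (continuity method): under the a priori improvement
`2δ-close ⇒ δ-close` for Tao-frame solutions from `u₀` on sub-slabs of `[0,T]`, EVERY Tao-frame
solution from `u₀` on `[0,T'] ⊆ [0,T]` is `δ`-close to the reference field `V` (jointly continuous,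
uniformly small at infinity), provided `u₀` is `δ/2`-close to `V(0)` and decays at infinity.  The
uniformity in `x` comes from the uniform spatial decay of frame solutions
(`IsClassicalNSSolutionOn.exists_forall_norm_le_of_datum_decay`) and uniform continuity on the
compact cylinder `[0,T'] × B̄(0,R)`. [folklore] -/
theorem frame_close_of_improvement {T δ : ℝ} (hδ : 0 < δ)
    {u₀ : EuclideanSpace ℝ (Fin 3) → EuclideanSpace ℝ (Fin 3)}
    {V : ℝ → EuclideanSpace ℝ (Fin 3) → EuclideanSpace ℝ (Fin 3)}
    (hVc : ContinuousOn (uncurry V) (Icc 0 T ×ˢ univ))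
    (hVinf : ∀ η : ℝ, 0 < η → ∃ R : ℝ, ∀ t ∈ Icc 0 T, ∀ x : EuclideanSpace ℝ (Fin 3),
      R ≤ ‖x‖ → ‖V t x‖ ≤ η)
    (h0 : ∀ x, ‖u₀ x - V 0 x‖ ≤ δ / 2)
    (hdec0 : ∀ η : ℝ, 0 < η → ∃ R : ℝ, ∀ y : EuclideanSpace ℝ (Fin 3), R ≤ ‖y‖ → ‖u₀ y‖ ≤ η)
    (himp : ∀ T' ∈ Ioc 0 T, ∀ (u : ℝ → EuclideanSpace ℝ (Fin 3) → EuclideanSpace ℝ (Fin 3))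
        (p : ℝ → EuclideanSpace ℝ (Fin 3) → ℝ), TaoFrame T' u p → u 0 = u₀ →
        (∀ t ∈ Icc 0 T', ∀ x, ‖u t x - V t x‖ ≤ 2 * δ) → ∀ t ∈ Icc 0 T', ∀ x, ‖u t x - V t x‖ ≤ δ)
    {T' : ℝ} (hT' : T' ∈ Ioc 0 T)
    {u : ℝ → EuclideanSpace ℝ (Fin 3) → EuclideanSpace ℝ (Fin 3)} {p : ℝ → EuclideanSpace ℝ (Fin 3) → ℝ}
    (hfr : TaoFrame T' u p) (hu0 : u 0 = u₀) :
    ∀ t ∈ Icc 0 T', ∀ x, ‖u t x - V t x‖ ≤ δ := by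
  -- continuity, boundedness and decay of `u`
  have hcont : ContinuousOn (uncurry u) (Icc 0 T' ×ˢ univ) := hfr.1.smooth_velocity.continuousOn
  have hEnn := TaoFrame.energy_nnreal hfr
  have h₀ := TaoFrame.sobolev_datum hfr hT'.1.le
  obtain ⟨⟨B, hB0, hB⟩, -⟩ := hfr.1.exists_norm_le_of_sobolevDatum_unforced one_pos hT'.1 hEnn h₀
  have hE' : ∃ C : ℝ≥0∞, C < ⊤ ∧ ∀ t ∈ Icc 0 T', ∫⁻ x, ‖u t x‖ₑ ^ 2 ≤ C := by
    obtain ⟨C, hC⟩ := hEnn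
    exact ⟨C, ENNReal.coe_lt_top, hC⟩
  have hbd : ∀ t ∈ Icc 0 T', ∀ y, ‖u t y‖ ≤ B + 1 := fun t ht y => (hB t ht y).trans (by linarith)
  have hdec0' : ∀ η : ℝ, 0 < η → ∃ R : ℝ, ∀ y : EuclideanSpace ℝ (Fin 3), R ≤ ‖y‖ → ‖u 0 y‖ ≤ η := by
    rw [hu0]; exact hdec0
  obtain ⟨Ru, hRu⟩ := hfr.1.exists_forall_norm_le_of_datum_decay hT'.1 hE' (by linarith) hbd hdec0'
    (half_pos hδ)
  obtain ⟨RV, hRV⟩ := hVinf (δ / 2) (half_pos hδ)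
  -- far field: `‖u - V‖ ≤ δ` for `‖x‖ ≥ R`, all times
  obtain ⟨R, hR_def⟩ : ∃ R : ℝ, R = max Ru RV := ⟨_, rfl⟩
  have hfar : ∀ t ∈ Icc 0 T', ∀ x, R ≤ ‖x‖ → ‖u t x - V t x‖ ≤ δ := by
    intro t ht x hx
    calc ‖u t x - V t x‖ ≤ ‖u t x‖ + ‖V t x‖ := norm_sub_le _ _
      _ ≤ δ / 2 + δ / 2 := add_le_add (hRu t ht x ((le_max_left Ru RV).trans (hR_def ▸ hx)))
          (hRV t ⟨ht.1, ht.2.trans hT'.2⟩ x ((le_max_right Ru RV).trans (hR_def ▸ hx)))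
      _ = δ := by ring
  -- the gap function is jointly continuous
  have hg : ContinuousOn (fun q : ℝ × EuclideanSpace ℝ (Fin 3) => ‖u q.1 q.2 - V q.1 q.2‖)
      (Icc 0 T' ×ˢ univ) := by
    have hV' : ContinuousOn (uncurry V) (Icc 0 T' ×ˢ univ) :=
      hVc.mono (prod_mono (Icc_subset_Icc_right hT'.2) Subset.rfl)
    exact (hcont.sub hV').norm
  have hgx : ∀ x, ContinuousOn (fun t : ℝ => ‖u t x - V t x‖) (Icc 0 T') := fun x =>
    hg.comp (f := fun t : ℝ => (t, x)) (continuousOn_id.prodMk continuousOn_const)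
      (fun t ht => mk_mem_prod ht (mem_univ x))
  -- suppose not
  by_contra hcon
  push Not at hcon
  obtain ⟨tb, htb, xb, hxb⟩ := hcon
  obtain ⟨Bad, hBad⟩ : ∃ Bad : Set ℝ, Bad = {t | t ∈ Icc 0 T' ∧ ∃ x, δ < ‖u t x - V t x‖} :=
    ⟨_, rfl⟩
  have hmemBad : ∀ {t}, t ∈ Bad ↔ t ∈ Icc 0 T' ∧ ∃ x, δ < ‖u t x - V t x‖ := by
    intro t; rw [hBad]; rfl
  have hne : Bad.Nonempty := ⟨tb, hmemBad.2 ⟨htb, xb, hxb⟩⟩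
  have hbdd : BddBelow Bad := ⟨0, fun t ht => (hmemBad.1 ht).1.1⟩
  obtain ⟨t₁, ht₁⟩ : ∃ t₁ : ℝ, t₁ = sInf Bad := ⟨_, rfl⟩
  have hinf_le : ∀ b ∈ Bad, t₁ ≤ b := fun b hb => by rw [ht₁]; exact csInf_le hbdd hb
  have ht₁0 : 0 ≤ t₁ := by rw [ht₁]; exact le_csInf hne fun t ht => (hmemBad.1 ht).1.1
  have ht₁T : t₁ ≤ T' := (hinf_le tb (hmemBad.2 ⟨htb, xb, hxb⟩)).trans htb.2
  have hgood_lt : ∀ t ∈ Icc 0 T', t < t₁ → ∀ x, ‖u t x - V t x‖ ≤ δ := by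
    intro t ht htlt x
    by_contra hx
    push Not at hx
    exact absurd (hinf_le t (hmemBad.2 ⟨ht, x, hx⟩)) (not_le.2 htlt)
  -- `t₁` itself is good
  have hgood₁ : ∀ x, ‖u t₁ x - V t₁ x‖ ≤ δ := by
    intro x
    by_contra hx
    push Not at hx
    rcases ht₁0.eq_or_lt with h0eq | hpos
    · have hx0 : δ < ‖u₀ x - V 0 x‖ := by rw [← hu0, h0eq]; exact hx
      linarith [h0 x]
    · have hct : ContinuousWithinAt (fun t => ‖u t x - V t x‖) (Icc 0 T') t₁ := hgx x t₁ ⟨ht₁0, ht₁T⟩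
      have hev : ∀ᶠ t in 𝓝[Icc 0 T'] t₁, δ < ‖u t x - V t x‖ := hct.eventually (lt_mem_nhds hx)
      obtain ⟨ε', hε', hball⟩ := Metric.eventually_nhds_iff.1 (eventually_nhdsWithin_iff.1 hev)
      obtain ⟨t, ht_def⟩ : ∃ t : ℝ, t = t₁ - min (ε' / 2) (t₁ / 2) := ⟨_, rfl⟩
      have hm₁ : min (ε' / 2) (t₁ / 2) ≤ ε' / 2 := min_le_left _ _
      have hm₂ : min (ε' / 2) (t₁ / 2) ≤ t₁ / 2 := min_le_right _ _
      have hmin_pos : 0 < min (ε' / 2) (t₁ / 2) := lt_min (by linarith) (by linarith)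
      have htlt : t < t₁ := by rw [ht_def]; linarith
      have ht0 : 0 ≤ t := by rw [ht_def]; linarith
      have htmem : t ∈ Icc 0 T' := ⟨ht0, by linarith⟩
      have hdist : dist t t₁ < ε' := by
        rw [Real.dist_eq, abs_of_nonpos (by linarith), ht_def]; linarith
      have hbad : δ < ‖u t x - V t x‖ := hball hdist htmem
      linarith [hgood_lt t htmem htlt x]
  have hgood_le : ∀ t ∈ Icc 0 T', t ≤ t₁ → ∀ x, ‖u t x - V t x‖ ≤ δ := by
    intro t ht htle x
    rcases htle.eq_or_lt with h | h
    · rw [h]; exact hgood₁ x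
    · exact hgood_lt t ht h x
  -- uniform continuity on the compact cylinder gives a uniform step
  obtain ⟨η, hη, hstep⟩ : ∃ η : ℝ, 0 < η ∧ ∀ t ∈ Icc 0 T', t₁ ≤ t → t ≤ t₁ + η →
      ∀ x : EuclideanSpace ℝ (Fin 3), ‖x‖ ≤ R → ‖u t x - V t x‖ < 2 * δ := by
    have hK : IsCompact (Icc 0 T' ×ˢ closedBall (0 : EuclideanSpace ℝ (Fin 3)) R) :=
      isCompact_Icc.prod (isCompact_closedBall 0 R)
    have hgK : ContinuousOn (fun q : ℝ × EuclideanSpace ℝ (Fin 3) => ‖u q.1 q.2 - V q.1 q.2‖)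
        (Icc 0 T' ×ˢ closedBall (0 : EuclideanSpace ℝ (Fin 3)) R) :=
      hg.mono (prod_mono Subset.rfl (subset_univ _))
    have huc := hK.uniformContinuousOn_of_continuous hgK
    rw [Metric.uniformContinuousOn_iff] at huc
    obtain ⟨η, hη, hηuc⟩ := huc δ hδ
    refine ⟨η / 2, half_pos hη, fun t ht h1t ht2 x hx => ?_⟩
    have hq₁ : (t₁, x) ∈ Icc 0 T' ×ˢ closedBall (0 : EuclideanSpace ℝ (Fin 3)) R :=
      mk_mem_prod ⟨ht₁0, ht₁T⟩ (mem_closedBall_zero_iff.2 hx)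
    have hq : (t, x) ∈ Icc 0 T' ×ˢ closedBall (0 : EuclideanSpace ℝ (Fin 3)) R :=
      mk_mem_prod ht (mem_closedBall_zero_iff.2 hx)
    have hd : dist (t, x) (t₁, x) < η := by
      rw [Prod.dist_eq, dist_self, max_eq_left dist_nonneg, Real.dist_eq, abs_of_nonneg (by linarith)]
      linarith
    have h := hηuc (t, x) hq (t₁, x) hq₁ hd
    rw [Real.dist_eq] at h
    have h1 := hgood₁ x
    have h2 := (abs_lt.1 h).2
    linarith
  -- the improved interval `[0, T'']`
  obtain ⟨T'', hT''_def⟩ : ∃ T'' : ℝ, T'' = min (t₁ + η) T' := ⟨_, rfl⟩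
  have hT''pos : 0 < T'' := by rw [hT''_def]; exact lt_min (by linarith) hT'.1
  have hT''le : T'' ≤ T' := by rw [hT''_def]; exact min_le_right _ _
  have hT''le' : T'' ≤ t₁ + η := by rw [hT''_def]; exact min_le_left _ _
  have hT''mem : T'' ∈ Ioc 0 T := ⟨hT''pos, hT''le.trans hT'.2⟩
  have hfr'' : TaoFrame T'' u p := TaoFrame.restrict hfr hT''pos hT''le
  have h2δ : ∀ t ∈ Icc 0 T'', ∀ x, ‖u t x - V t x‖ ≤ 2 * δ := by
    intro t ht x
    have ht' : t ∈ Icc 0 T' := ⟨ht.1, ht.2.trans hT''le⟩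
    rcases le_or_gt t t₁ with h | h
    · exact (hgood_le t ht' h x).trans (by linarith)
    · rcases le_or_gt R ‖x‖ with hx | hx
      · exact (hfar t ht' x hx).trans (by linarith)
      · exact (hstep t ht' h.le (ht.2.trans hT''le') x hx.le).le
  have himp' := himp T'' hT''mem u p hfr'' hu0 h2δ
  -- contradiction with the definition of `t₁`
  rcases le_or_gt (t₁ + η) T' with hle | hlt
  · have hT''eq : T'' = t₁ + η := by rw [hT''_def]; exact min_eq_left hle
    have hlt' : sInf Bad < t₁ + η := by rw [← ht₁]; linarith
    obtain ⟨b, hb, hblt⟩ := exists_lt_of_csInf_lt hne hlt'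
    obtain ⟨hbI, x, hx⟩ := hmemBad.1 hb
    have := himp' b ⟨hbI.1, by rw [hT''eq]; exact hblt.le⟩ x
    linarith
  · have hT''eq : T'' = T' := by rw [hT''_def]; exact min_eq_right hlt.le
    have := himp' tb (by rw [hT''eq]; exact htb) xb
    linarith

/-! ### P2 PROVED -/

/-- **(P2) PROVED**: the frame bootstrap, from Leray's alternative for smooth finite-energy solutions
(`finiteEnergy_classical_dichotomy`: global-on-closed-slabs or a maximal solution with UNBOUNDED
velocity), Tao's persistence of regularity (`hasBoundedSobolevNormsOn_of_sobolevDatum_unforced`) and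
the connectedness argument `frame_close_of_improvement` (the `δ`-closeness caps the velocity by
`sup|V| + δ`, excluding the blow-up branch before time `T`). [folklore] -/
theorem frameBootstrap_holds : FrameBootstrap := by
  intro T δ u₀ V hT hδ hu₀s hu₀div hu₀cpt hVc hVB hVinf h0 himp
  -- the datum is in `H^∞` and decays
  have hH : ∀ n : ℕ, ∫⁻ x, ‖iteratedFDeriv ℝ n u₀ x‖ₑ ^ 2 < ⊤ := by
    intro n
    have hc : Continuous (iteratedFDeriv ℝ n u₀) :=
      hu₀s.continuous_iteratedFDeriv (by exact_mod_cast le_top)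
    have hcs : HasCompactSupport (iteratedFDeriv ℝ n u₀) := hu₀cpt.iteratedFDeriv n
    have hmem : MemLp (iteratedFDeriv ℝ n u₀) 2 volume := hc.memLp_of_hasCompactSupport hcs
    have h2 := lintegral_rpow_enorm_lt_top_of_eLpNorm_lt_top (by norm_num) (by simp) hmem.eLpNorm_lt_top
    simpa using h2
  have hdec0 : ∀ η : ℝ, 0 < η → ∃ R : ℝ, ∀ y : EuclideanSpace ℝ (Fin 3), R ≤ ‖y‖ → ‖u₀ y‖ ≤ η := by
    intro η hη
    obtain ⟨r, hr⟩ := hu₀cpt.isCompact.isBounded.subset_closedBall (0 : EuclideanSpace ℝ (Fin 3))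
    refine ⟨r + 1, fun y hy => ?_⟩
    have hy' : y ∉ tsupport u₀ := fun h => by
      have := mem_closedBall_zero_iff.1 (hr h); linarith
    rw [image_eq_zero_of_notMem_tsupport hy', norm_zero]; exact hη.le
  have claim : ∀ T' ∈ Ioc 0 T, ∀ (u : ℝ → EuclideanSpace ℝ (Fin 3) → EuclideanSpace ℝ (Fin 3))
      (p : ℝ → EuclideanSpace ℝ (Fin 3) → ℝ), TaoFrame T' u p → u 0 = u₀ →
      ∀ t ∈ Icc 0 T', ∀ x, ‖u t x - V t x‖ ≤ δ :=
    fun T' hT' u p hfr hu0 => frame_close_of_improvement hδ hVc hVinf h0 hdec0 himp hT' hfr hu0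
  rcases finiteEnergy_classical_dichotomy one_pos hu₀s hu₀div hH with hgoodAll | hbad
  · obtain ⟨u, p, hcl, hu0, A, hAtop, hE⟩ := hgoodAll T hT
    have hEnn : ∃ C : ℝ≥0, ∀ t ∈ Icc 0 T, ∫⁻ x, ‖u t x‖ₑ ^ 2 ≤ C :=
      ⟨A.toNNReal, fun t ht => (hE t ht).trans (ENNReal.coe_toNNReal hAtop.ne).symm.le⟩
    have hsob := hcl.hasBoundedSobolevNormsOn_of_sobolevDatum_unforced one_pos hT hEnn
      (by rw [hu0]; exact hH)
    have hfr : TaoFrame T u p := taoFrame_of_class hcl hsob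
    exact ⟨u, p, hfr, hu0, claim T ⟨hT, le_rfl⟩ u p hfr hu0⟩
  · obtain ⟨Ts, hTs, u, p, hcl, hu0, ⟨A, hAtop, hE⟩, hunb, -⟩ := hbad
    have hsub : ∀ T' : ℝ, 0 < T' → T' < Ts → TaoFrame T' u p := by
      intro T' hT'0 hT'Ts
      have hcl' : IsClassicalNSSolutionOn (Icc 0 T') 1 0 u p :=
        hcl.mono (Icc_subset_Ico_right hT'Ts) (uniqueDiffOn_Icc hT'0)
      have hEnn : ∃ C : ℝ≥0, ∀ t ∈ Icc 0 T', ∫⁻ x, ‖u t x‖ₑ ^ 2 ≤ C :=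
        ⟨A.toNNReal, fun t ht =>
          (hE t ⟨ht.1, lt_of_le_of_lt ht.2 hT'Ts⟩).trans (ENNReal.coe_toNNReal hAtop.ne).symm.le⟩
      have hsob := hcl'.hasBoundedSobolevNormsOn_of_sobolevDatum_unforced one_pos hT'0 hEnn
        (by rw [hu0]; exact hH)
      exact taoFrame_of_class hcl' hsob
    by_cases hTT : T < Ts
    · have hfr := hsub T hT hTT
      exact ⟨u, p, hfr, hu0, claim T ⟨hT, le_rfl⟩ u p hfr hu0⟩
    · push Not at hTT
      exfalso
      obtain ⟨BV, hBV⟩ := hVB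
      obtain ⟨t, ht, x, hx⟩ := hunb (BV + δ)
      set T' : ℝ := (t + Ts) / 2 with hT'_def
      have hT'0 : 0 < T' := by rw [hT'_def]; linarith [ht.1, hTs]
      have htT' : t ≤ T' := by rw [hT'_def]; linarith [ht.2]
      have hT'Ts : T' < Ts := by rw [hT'_def]; linarith [ht.2]
      have hfr := hsub T' hT'0 hT'Ts
      have hclose := claim T' ⟨hT'0, by linarith⟩ u p hfr hu0 t ⟨ht.1, htT'⟩ x
      have hux : ‖u t x‖ ≤ BV + δ := by
        calc ‖u t x‖ = ‖(u t x - V t x) + V t x‖ := by rw [sub_add_cancel]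
          _ ≤ ‖u t x - V t x‖ + ‖V t x‖ := norm_add_le _ _
          _ ≤ δ + BV := add_le_add hclose (hBV t ⟨ht.1, by linarith [ht.2]⟩ x)
          _ = BV + δ := add_comm _ _
      linarith

/-- The registered closed form of (P2), PROVED. -/
theorem stubFrameBootstrap_holds : StubFrameBootstrap := frameBootstrap_holds

/-- **P2 BY NAME** — `stub_frameBootstrap : StubFrameBootstrap` (the workfile's registered-shape name). -/
theorem stub_frameBootstrap : StubFrameBootstrap := stubFrameBootstrap_holds

end Summit.NavierStokesRegularity.NavierStokesRegularity.Cruxes.TypeIQuantSubcubicExp.TruncationEdge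

end
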